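import Summits.QuantumFields.BalabanUV.InfraRed.StrongCouplingTwelveSeventhsCovariance
import Summits.QuantumFields.BalabanUV.InfraRed.StrongCouplingSlabAxialClustering
import HarnessLib

/-!
# Strong-coupling front, rung F4(12/7) PROVED (part 4/4): the quarter modulus `OneLinkKRModulusSU2 β_W (1/4)` for every
Wilson `0 ≤ β_W ≤ 2/7`, hence the infinite-volume transfer-operator gap (currency SC-c) at EVERY `0 ≤ β_W < 2/7` through
the axial-gauge door — observatory of the non-perturbative crossover; no mass-gap claim

IR-3 v2 TWO-FRONT CROSSOVER LEDGER, front SC (`β₀`), SU(2), `d = 4`, Wilson normalisation `β_W = 4/g²`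
(tree bare coupling `β_t = β_W/2`, 't Hooft `β_W/4`).
ABSOLUTE RULE of this package: No internally-minted statement may enter as a cited fact. Every hypothesis is either
kernel-proved in this package or a verbatim quotation of a PUBLISHED theorem with page reference. The manuscript(s)
under audit are NOT citable for their own disputed steps — they are the thing under adjudication; programme-internal
(2001/route/tribunal) claims are never citable.

WHAT THIS FILE PROVES (kernel, every hypothesis discharged).
* `oneLinkKRModulusSU2_of_le_twoSevenths`: for `β_W ≤ 2/7` the `SU(2)` one-link Kantorovich–Rubinstein modulus with
  the floor constant `K₂ = 1/4` on the ball `‖B‖_op ≤ 3β_W/2 ≤ 3/7` — integration of part 3's covariance bound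
  `quarterCovariance127` along the segment `B_t = B + t(B′ − B)` (the tree's `abs_integral_tilted_add_sub_le_of_cov`,
  exactly as in `StrongCouplingQuarterModulusFourFifteenths.oneLinkKRModulusSU2_of_le_fourFifteenths`).
* `quarterModulusUpTo_twoSevenths : QuarterModulusUpTo (2/7)` (the forest-gauge line's modulus predicate; its SC-b
  door `D = 15` does not open beyond `4/15`, so SC-b is NOT moved by this file).
* `su2_latticeMassGap_axial_lt_twoSevenths`: currency SC-c `CrossoverLedger.LatticeMassGap (fundamentalRep (Fin 2))
  (β_W/2) (krRate (14 · β_W · (1/4)))` — a transfer-operator gap `Sufficient.TransferOperatorGap` on every time-zero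
  torus `S ≥ 1` — at EVERY Wilson `0 ≤ β_W < 2/7 = 0.2857…`, through the axial-gauge door
  `StrongCouplingSlabAxialClustering.su2_latticeMassGap_of_oneLinkKRModulusSU2_axial` (Dobrushin constant `14`, window
  `14 · β_W · (1/4) < 1 ⟺ β_W < 2/7`; endpoint NOT attained — strict row sum).  Instances at `β_W = 7/25 = 0.28`
  (rate `krRate (49/50) = −log 0.98 = 0.0202…`) and at `β_W = 27/100` (rate `−log 0.945 = 0.0565…`).

LEDGER CONSEQUENCE (stated, not adjudicated here): the package's number in currency SC-c moves from the closed window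
`β_W ≤ 4/15 = 0.2667` (`StrongCouplingSlabAxialClustering`) to the half-open window `β_W < 2/7 = 0.2857`; SC-b stays
`β_W < 4/15` (forest door, `D = 15`), SC-a stays `β_W < 2/9` (comb door).  With `K₂ = 1/4` the axial door is now
exhausted: `2/7` is where `14 · β_W · K₂ = 1`.

NOT CLAIMED: no mass-gap claim; nothing at or beyond `β_W = 2/7`; `krRate` is the Dobrushin rate of the method, not a
physical mass; nothing about the continuum, `N ≥ 3`, scaling or the crossover itself; NOT Bałaban's renormalisation
group; the manuscripts under audit are cited nowhere.
-/

noncomputable section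

open MeasureTheory Filter Topology ProbabilityTheory Finset Real
open scoped NNReal Quaternion
open Literature.Probability.LatticeModels
open Literature.MathematicalPhysics.QuantumLattice (fundamentalRep fundamentalLatticeRep quatMatrix su2Quat quatToSU2)
open Literature.MathematicalPhysics.QuantumFieldTheory
open Literature.MathematicalPhysics.QuantumFieldTheory.Balaban1983to89
open Literature.MathematicalPhysics.QuantumFieldTheory.Balaban1983to89.StrongCouplingDobrushinWindow
open Literature.MathematicalPhysics.QuantumFieldTheory.Balaban1983to89.StrongCouplingTorusWindow
open Literature.MathematicalPhysics.QuantumFieldTheory.Balaban1983to89.StrongCouplingKernelWindow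
open Literature.MathematicalPhysics.QuantumFieldTheory.Balaban1983to89.StrongCouplingOpenWindow
open Literature.MathematicalPhysics.QuantumFieldTheory.Balaban1983to89.StrongCouplingVarianceWindow
open Summit.QuantumFields.BalabanUV.InfraRed.StrongCouplingSixFifthsVariance
open Summit.QuantumFields.BalabanUV.InfraRed.StrongCouplingReflection
open Summit.QuantumFields.BalabanUV.InfraRed.StrongCouplingTransverseMoment
open Summit.QuantumFields.BalabanUV.InfraRed.StrongCouplingQuarterCovariance
open Summit.QuantumFields.BalabanUV.InfraRed.StrongCouplingTwelveSeventhsCovariance (quarterCovariance127)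
open Summit.QuantumFields.BalabanUV.InfraRed.StrongCouplingForestGauge (QuarterModulusUpTo)
open Summit.QuantumFields.BalabanUV.InfraRed.StrongCouplingSlabAxialClustering
  (su2_latticeMassGap_of_oneLinkKRModulusSU2_axial)

namespace Summit.QuantumFields.BalabanUV.InfraRed.StrongCouplingQuarterModulusTwoSevenths

/-! ## 1. The one-link quarter modulus up to `β_W = 2/7` -/

/-- **The `SU(2)` one-link quarter modulus for `β_W ≤ 2/7`** (`‖B‖_op, ‖B′‖_op ≤ 3β_W/2 ≤ 3/7`): for every bounded
measurable `L`-Lipschitz `φ`, `|∫ φ dν_B − ∫ φ dν_{B′}| ≤ 4 · (1/4) · L · ‖B − B′‖_F` — integration of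
`quarterCovariance127` along the segment, which stays in the ball `‖B_t‖_op ≤ 3/7`. [folklore] -/
theorem oneLinkKRModulusSU2_of_le_twoSevenths {βW : ℝ} (h27 : βW ≤ 2 / 7) :
    OneLinkKRModulusSU2 βW (1 / 4) := by
  classical
  intro B B' hB hB' φ L hφm hφb hL hφL
  have h2 : ((2 : ℕ) : ℝ) = 2 := by norm_num
  rw [h2, show (4 : ℝ) * (1 / 4) = 1 by norm_num, one_mul]
  set f : Matrix.specialUnitaryGroup (Fin 2) ℂ → ℝ := fun g => (2 : ℝ) * (((g : Matrix (Fin 2) (Fin 2) ℂ) * B).trace.re) with hf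
  set w : Matrix.specialUnitaryGroup (Fin 2) ℂ → ℝ := fun g => (2 : ℝ) * (((g : Matrix (Fin 2) (Fin 2) ℂ) * (B' - B)).trace.re) with hw
  have hfw : (fun g : Matrix.specialUnitaryGroup (Fin 2) ℂ => (2 : ℝ) * (((g : Matrix (Fin 2) (Fin 2) ℂ) * B').trace.re)) = fun g => f g + w g := by
    funext g
    simp only [hf, hw, Matrix.mul_sub, Matrix.trace_sub, Complex.sub_re]
    ring
  rw [hfw, abs_sub_comm]
  have hfm : Measurable f := (continuous_pot B).measurable
  have hwm : Measurable w := (continuous_pot (B' - B)).measurable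
  have hfb : ∃ C, ∀ s, |f s| ≤ C := ⟨_, abs_pot_le B⟩
  have hwb : ∀ s, |w s| ≤ 2 * (Real.sqrt 2 * frobNorm (B' - B)) := abs_pot_le (B' - B)
  have key := abs_integral_tilted_add_sub_le_of_cov (μ := (haarProbability (Matrix.specialUnitaryGroup (Fin 2) ℂ))) (A := L * frobNorm (B' - B)) hfm hfb hwm hwb hφm hφb ?_
  · rw [frobNorm_sub_comm]; exact key
  · intro t ht
    set Bt : Matrix (Fin 2) (Fin 2) ℂ := B + (t : ℂ) • (B' - B) with hBt
    have hft : (fun u : Matrix.specialUnitaryGroup (Fin 2) ℂ => f u + t * w u) = pot Bt := by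
      funext g
      simp only [hf, hw, hBt, pot, Matrix.mul_add, Matrix.mul_smul, Matrix.trace_add, Matrix.trace_smul,
        Complex.add_re, smul_eq_mul, Complex.re_ofReal_mul]
      ring
    have hBt_le : matrixOpNorm Bt ≤ 3 / 7 := by
      have h1 : Bt = ((1 - t : ℝ) : ℂ) • B + ((t : ℝ) : ℂ) • B' := by
        rw [hBt]
        push_cast
        simp only [smul_sub, sub_smul, one_smul]
        abel
      rw [h1]
      calc matrixOpNorm (((1 - t : ℝ) : ℂ) • B + ((t : ℝ) : ℂ) • B')
          ≤ matrixOpNorm (((1 - t : ℝ) : ℂ) • B) + matrixOpNorm (((t : ℝ) : ℂ) • B') := matrixOpNorm_add_le _ _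
        _ = (1 - t) * matrixOpNorm B + t * matrixOpNorm B' := by
            rw [matrixOpNorm_smul, matrixOpNorm_smul, Complex.norm_real, Complex.norm_real, Real.norm_eq_abs,
              Real.norm_eq_abs, abs_of_nonneg (by linarith [ht.2]), abs_of_nonneg ht.1]
        _ ≤ (1 - t) * (3 * βW / 2) + t * (3 * βW / 2) :=
            add_le_add (mul_le_mul_of_nonneg_left hB (by linarith [ht.2])) (mul_le_mul_of_nonneg_left hB' ht.1)
        _ ≤ 3 / 7 := by linarith
    rw [hft]
    exact quarterCovariance127 Bt (B' - B) hBt_le φ L hφm hφb hL hφL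

/-- The forest-gauge line's modulus predicate up to `2/7`: `QuarterModulusUpTo (2/7)` (its SC-b door `D = 15` is not
opened beyond `4/15` by this — recorded for the ledger's lever map only). [folklore] -/
theorem quarterModulusUpTo_twoSevenths : QuarterModulusUpTo (2 / 7) := fun _ _ hlt =>
  oneLinkKRModulusSU2_of_le_twoSevenths hlt.le

/-! ## 2. Currency SC-c below `2/7`, every hypothesis discharged -/

/-- **SC-c at every Wilson `0 ≤ β_W < 2/7`**: the infinite-volume transfer-operator gap
`CrossoverLedger.LatticeMassGap (fundamentalRep (Fin 2)) (β_W/2) (krRate (14 · β_W · (1/4)))` — the axial-gauge door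
(`su2_latticeMassGap_of_oneLinkKRModulusSU2_axial`, window `14 · β_W · K₂ < 1`) × the quarter modulus of §1; no
hypothesis. [folklore] -/
theorem su2_latticeMassGap_axial_lt_twoSevenths {βW : ℝ} (h0 : 0 ≤ βW) (hlt : βW < 2 / 7) :
    CrossoverLedger.LatticeMassGap (fundamentalRep (Fin 2)) (βW / 2) (krRate (14 * βW * (1 / 4))) :=
  su2_latticeMassGap_of_oneLinkKRModulusSU2_axial h0 (by norm_num) (oneLinkKRModulusSU2_of_le_twoSevenths hlt.le)
    (by linarith)

/-- **SC-c instance at `β_W = 7/25 = 0.28`** (`g² = 100/7`, tree coupling `7/50`; rate `krRate (49/50) = −log 0.98`).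
[folklore] -/
theorem su2_latticeMassGap_axial_sevenTwentyFifths :
    CrossoverLedger.LatticeMassGap (fundamentalRep (Fin 2)) ((7 / 25 : ℝ) / 2) (krRate (14 * (7 / 25 : ℝ) * (1 / 4))) :=
  su2_latticeMassGap_axial_lt_twoSevenths (by norm_num) (by norm_num)

/-- SC-c instance at `β_W = 27/100` (tree coupling `27/200`; rate `krRate (189/200) = −log 0.945`). [folklore] -/
theorem su2_latticeMassGap_axial_twentySevenHundredths :
    CrossoverLedger.LatticeMassGap (fundamentalRep (Fin 2)) ((27 / 100 : ℝ) / 2)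
      (krRate (14 * (27 / 100 : ℝ) * (1 / 4))) :=
  su2_latticeMassGap_axial_lt_twoSevenths (by norm_num) (by norm_num)

end Summit.QuantumFields.BalabanUV.InfraRed.StrongCouplingQuarterModulusTwoSevenths
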